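import Literature.AlgebraicGeometry.HodgeTheory.ComplexTorusComparisonRigidity
import Literature.AlgebraicGeometry.HodgeTheory.ComplexTorusHodgeClassesComparison
import Literature.Geometry.Kaehler.ComplexTorusReindex
import Literature.AlgebraicGeometry.HodgeTheory.LefschetzOneOneProofs
import Literature.AlgebraicTopology.SingularHomology.IntegralClassRingChange
import HarnessLib

/-!
# Rational and integral classes of a complex torus through a natural de Rham family: any index type,
# and the converse comparison for rationally normalised families

Layer `Literature/AlgebraicGeometry/HodgeTheory`; lane `lit-hodgefound`, row P-pre-28 (A1/A4 glue),
third part. `ComplexTorusComparisonRigidity.lean` proves, for a torus presented on `Fin n` (so that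
`ComplexTorus Φ` is literally `(ℝ/ℤ)ⁿ`), that every NATURAL complex de Rham family `e` is a scalar
multiple `g · normalisedComparison` on `Hᵏ(X; ℤ)` and, for a normalised family, the dictionary
`IsIntegralClass (e_X[γ]) ↔ γ ∈ integralForms Φ k`, `IsRationalClass (e_X[γ]) ↔ γ ∈ rationalForms Φ k`.
Here:

* §1 **transport between two presentations of the same torus** (`Φ : ℝ^ι ≃ E`, `Φ' : ℝ^{ι'} ≃ E` with
  integer matrices `A`, `B` of trivial analytic representation `ρ(A) = ρ(B) = id_E`, e.g. a reindexing
  `Φ' = ComplexTorus.reindex Φ e`, `ComplexTorusReindex.lean`): for a natural family,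
  `e_Φ[γ] = (mapMatrix A)^* e_{Φ'}[γ]` (`apply_cconstClass_eq_map_of_realRep_eq_id`), hence
  `IsRationalClass (e_Φ[γ]) ↔ IsRationalClass (e_{Φ'}[γ])` and the same for `IsIntegralClass`
  (pull-backs `IsRationalClass.pullback`, `IsIntegralClass.map`; Lange 2023, §1.1.2: the rational /
  analytic representations, here of the identity of `E/Λ`); §1b `normalisedComparison_map_torusMap` —
  the normalised comparison is EQUIVARIANT for the endomorphisms `f_A`, `A ∈ Mₙ(ℤ)`:
  `normalisedComparison (f_A^* x) = normalisedComparison x ∘ ρ(A)` (through any natural family);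
* §2 **the converse of `isRationalClass_of_mem_rationalForms`** (`ComplexTorusHodgeClassesComparison.lean`)
  for a natural family which is RATIONALLY NORMALISED in degree `k` (`IsRationalDeRhamFamily e k`, the
  currency of the conjugation-chart files; such families exist, `exists_isRational_complexDeRhamIsoFamily_holds`):
  the rigidity scalar `g` is rational (`exists_ratCast_apply_cconstClass_latMonomial_eq_smul`, by
  `torusMonomialBasis_repr_mem_range_ratCast`), so **`IsRationalClass (e_X[γ]) ↔ γ ∈ rationalForms Φ k`**
  — first on `Fin n` (`…_fin`), then for EVERY finite index type by reindexing
  (`isRationalClass_iff_mem_rationalForms_of_isRational`): Lange 2023, Lemma 1.1.17 / Cor. 1.1.19 /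
  Prop. 1.1.20 — "`Hᵏ(X, ℚ) ⊂ Hᵏ(X, ℂ)` is the space of invariant forms with rational periods" — for the
  tree's abstract comparisons;
  and `mem_hodgeClasses(In)_iff_isRationalClass_of_isRational`: **the concrete Hodge classes
  `hodgeClasses Φ p` are exactly the invariant forms whose singular class is rational and whose de Rham
  class lies in `H^{p,p}(X)`** (the model layer's Hodge classes, §7.2.2; `cconstClass_mem_hodgePQ_iff`);
* §3 the `Fin n` integral / rational dictionary of `ComplexTorusComparisonRigidity.lean` transported to
  an arbitrary presentation `Φ : ℝ^ι ≃ E` normalised on its reindexing `reindex Φ β`, `β : ι ≃ Fin n`.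

Theorems only; no definition, no named fact.

## References

* [Lange2023AbelianVarietiesComplex] H. Lange, *Abelian Varieties over the Complex Numbers* (2023),
  §1.1.2, §1.1.3 Lemma 1.1.17 / Cor. 1.1.19, §1.1.4 Prop. 1.1.20.
* [HatcherAT2002] A. Hatcher, *Algebraic Topology* (2002), §3.1 p. 198 (change of coefficients,
  induced homomorphisms).
-/

noncomputable section

open scoped Manifold ContDiff
open ContinuousAlternatingMap Function Module
open Literature.NumberTheory.Transcendental Literature.Geometry.Kaehler
open Literature.AlgebraicTopology.SingularHomology Literature.LinearAlgebra.Alternating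

namespace Literature.AlgebraicGeometry.HodgeTheory

/-! ### §1 Transport between two presentations of the same torus -/

section Transport

variable {ι ι' : Type} [Fintype ι] [Fintype ι'] {E : Type} [NormedAddCommGroup E] [NormedSpace ℂ E]
  (Φ : (ι → ℝ) ≃L[ℝ] E) (Φ' : (ι' → ℝ) ≃L[ℝ] E) {k : ℕ} {e : ComplexDeRhamIsoFamily E}

/-- **Naturality across two presentations.** If the integer matrix `A ∈ M(ι' × ι, ℤ)` has trivial
analytic representation `ρ(A) = Φ' A_ℝ Φ⁻¹ = id_E` (the identity of `E/Λ` read from `Φ`- to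
`Φ'`-coordinates, e.g. `reindexMatrix`), then for a NATURAL family
`e_Φ[γ] = (mapMatrix A)^* e_{Φ'}[γ]` for every invariant form `γ`
(`(mapMatrix A)^*[γ]_{Φ'} = [γ ∘ ρ(A)]_Φ = [γ]_Φ`). [cite: Lange2023AbelianVarietiesComplex, §1.1.2 and §1.1.4] -/
theorem apply_cconstClass_eq_map_of_realRep_eq_id (he : e.IsNatural) (A : Matrix ι' ι ℤ)
    (hA : ComplexTorus.realRep Φ Φ' A = ContinuousLinearMap.id ℝ E) (γ : E [⋀^Fin k]→L[ℝ] ℂ) :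
    e (ComplexTorus Φ) k (ComplexTorus.cconstClass Φ γ) =
      singularCohomology.map ℂ ℂ ⟨ComplexTorus.mapMatrix Φ Φ' A,
        (ComplexTorus.contMDiff_real_mapMatrix (Φ := Φ) (Φ' := Φ') (n := ∞) A).continuous⟩ k
        (e (ComplexTorus Φ') k (ComplexTorus.cconstClass Φ' γ)) := by
  have hF := ComplexTorus.contMDiff_real_mapMatrix (Φ := Φ) (Φ' := Φ') (n := ∞) A
  have hγ : γ.compContinuousLinearMap (ComplexTorus.realRep Φ Φ' A) = γ := by
    rw [hA]
    exact ContinuousAlternatingMap.ext fun v ↦ rfl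
  rw [← he _ _ _ hF k, ComplexTorus.cmap_cconstClass_mapMatrix₂ Φ Φ' A γ, hγ]

/-- **Rationality of `e[γ]` does not depend on the presentation**: with integer matrices `A`, `B` of
trivial analytic representation in both directions (e.g. `reindexMatrix`, `reindexMatrixInv`),
`IsRationalClass (e_Φ[γ]) ↔ IsRationalClass (e_{Φ'}[γ])` for a natural family (pull back both ways).
[cite: Lange2023AbelianVarietiesComplex, §1.1.2] -/
theorem isRationalClass_apply_cconstClass_iff_of_realRep_eq_id (he : e.IsNatural)
    (A : Matrix ι' ι ℤ) (hA : ComplexTorus.realRep Φ Φ' A = ContinuousLinearMap.id ℝ E)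
    (B : Matrix ι ι' ℤ) (hB : ComplexTorus.realRep Φ' Φ B = ContinuousLinearMap.id ℝ E)
    {γ : E [⋀^Fin k]→L[ℝ] ℂ} :
    IsRationalClass (e (ComplexTorus Φ) k (ComplexTorus.cconstClass Φ γ)) ↔
      IsRationalClass (e (ComplexTorus Φ') k (ComplexTorus.cconstClass Φ' γ)) := by
  constructor
  · intro h
    rw [apply_cconstClass_eq_map_of_realRep_eq_id Φ' Φ he B hB γ]
    exact h.pullback _
  · intro h
    rw [apply_cconstClass_eq_map_of_realRep_eq_id Φ Φ' he A hA γ]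
    exact h.pullback _

/-- **Integrality of `e[γ]` does not depend on the presentation** (same transport, `IsIntegralClass`).
[cite: Lange2023AbelianVarietiesComplex, §1.1.2] -/
theorem isIntegralClass_apply_cconstClass_iff_of_realRep_eq_id (he : e.IsNatural)
    (A : Matrix ι' ι ℤ) (hA : ComplexTorus.realRep Φ Φ' A = ContinuousLinearMap.id ℝ E)
    (B : Matrix ι ι' ℤ) (hB : ComplexTorus.realRep Φ' Φ B = ContinuousLinearMap.id ℝ E)
    {γ : E [⋀^Fin k]→L[ℝ] ℂ} :
    IsIntegralClass (e (ComplexTorus Φ) k (ComplexTorus.cconstClass Φ γ)) ↔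
      IsIntegralClass (e (ComplexTorus Φ') k (ComplexTorus.cconstClass Φ' γ)) := by
  constructor
  · intro h
    rw [apply_cconstClass_eq_map_of_realRep_eq_id Φ' Φ he B hB γ]
    exact h.map _
  · intro h
    rw [apply_cconstClass_eq_map_of_realRep_eq_id Φ Φ' he A hA γ]
    exact h.map _

end Transport

/-! ### §1b The normalised comparison commutes with the endomorphisms `f_A` -/

section Endomorphisms

variable {n : ℕ} {E : Type} [NormedAddCommGroup E] [NormedSpace ℂ E] (Φ : (Fin n → ℝ) ≃L[ℝ] E)
  {k : ℕ}

/-- **The normalised comparison is equivariant for the endomorphisms of the torus**: for every integer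
matrix `A ∈ Mₙ(ℤ)` (endomorphism `f_A = mapMatrix A` of `X = E/Φ(ℤⁿ)`, analytic representation
`ρ(A)`), `normalisedComparison (f_A^* x) = (normalisedComparison x) ∘ ρ(A)` on `Hᵏ(X; ℤ)` — the action
of `End(X)` on `Hᵏ(X, ℤ) = ⋀ᵏ Hom(Λ, ℤ)` through the rational representation (Lange 2023, §1.1.2–1.1.3).
Proof through any natural de Rham family `e` (de Rham's theorem): both sides have the same class
`g · f_A^*(x ⊗ 1)` by rigidity, naturality (`apply_cconstClass_comp_realRep`) and
`singularCohomology.ringChange_map`, and `γ ↦ e_X[γ]` is injective.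
[cite: Lange2023AbelianVarietiesComplex, §1.1.2 and §1.1.3 Lemma 1.1.17] -/
theorem normalisedComparison_map_torusMap (A : Matrix (Fin n) (Fin n) ℤ)
    (x : singularCohomology ℤ ℤ (Torus n) k) :
    ComplexTorus.normalisedComparison Φ k (singularCohomology.map ℤ ℤ (torusMap A) k x) =
      (ComplexTorus.normalisedComparison Φ k x).compContinuousLinearMap (ComplexTorus.realRep Φ Φ A) := by
  haveI : FiniteDimensional ℝ E := LinearEquiv.finiteDimensional Φ.toLinearEquiv
  haveI : FiniteDimensional ℂ E := Module.Finite.of_restrictScalars_finite ℝ ℂ E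
  obtain ⟨e, he⟩ := exists_complexDeRhamIsoFamily_holds E
  obtain ⟨g, -, hg⟩ := exists_apply_cconstClass_normalisedComparison_eq_smul Φ (k := k) he
  apply injective_apply_cconstClass Φ e
  change e (ComplexTorus Φ) k (ComplexTorus.cconstClass Φ _) =
    e (ComplexTorus Φ) k (ComplexTorus.cconstClass Φ _)
  rw [hg, apply_cconstClass_comp_realRep Φ he, hg, singularCohomology.ringChange_map]
  change g • singularCohomology.map ℂ ℂ (torusMap A) k
      (singularCohomology.ringChange (Int.castRingHom ℂ) (Torus n) k x) =
    singularCohomology.map ℂ ℂ (torusMap A) k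
      (g • singularCohomology.ringChange (Int.castRingHom ℂ) (Torus n) k x)
  rw [map_smul]

end Endomorphisms

/-! ### §2 Rationally normalised natural families: the scalar is rational; `IsRationalClass ↔ rationalForms` -/

section RationallyNormalised

variable {n : ℕ} {E : Type} [NormedAddCommGroup E] [NormedSpace ℂ E] (Φ : (Fin n → ℝ) ≃L[ℝ] E)
  {k : ℕ} {e : ComplexDeRhamIsoFamily E}

/-- `subsetEmb ∘ ofFinEmbEquiv = id` (private plumbing). [folklore] -/
private theorem coe_subsetEmb_ofFinEmbEquiv {w : Fin k → Fin n} (hw : StrictMono w) :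
    ((subsetEmb (Set.powersetCard.ofFinEmbEquiv (OrderEmbedding.ofStrictMono w hw)) :
      Fin k ↪o Fin n) : Fin k → Fin n) = w := by
  rw [show subsetEmb (Set.powersetCard.ofFinEmbEquiv (OrderEmbedding.ofStrictMono w hw)) =
      OrderEmbedding.ofStrictMono w hw from Equiv.symm_apply_apply _ _]
  rfl

/-- **For a rationally normalised natural family the rigidity scalar is rational**: if `e` is natural and
`IsRationalDeRhamFamily e k`, there is `q ∈ ℚ`, `q ≠ 0`, with `e_X[dx_w] = q · ξ_w` for all increasing `w`
(`e_X[dx_w]` is a rational class, `isRationalClass_of_mem_rationalForms`, and equals `g · ξ_w`; the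
coordinates of rational classes in the cup-monomial basis are rational,
`torusMonomialBasis_repr_mem_range_ratCast`). [cite: Lange2023AbelianVarietiesComplex, §1.1.4 Prop. 1.1.20] -/
theorem exists_ratCast_apply_cconstClass_latMonomial_eq_smul (he : e.IsNatural)
    (hr : IsRationalDeRhamFamily e k) :
    ∃ q : ℚ, q ≠ 0 ∧ ∀ w : Fin k → Fin n, StrictMono w →
      e (ComplexTorus Φ) k (ComplexTorus.cconstClass Φ (ComplexTorus.latMonomial Φ k w)) =
        ((q : ℚ) : ℂ) • torusMonomial ℂ n k w := by
  obtain ⟨g, hg0, hg⟩ := exists_apply_cconstClass_latMonomial_eq_smul Φ (k := k) he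
  by_cases hex : ∃ w₀ : Fin k → Fin n, StrictMono w₀
  · obtain ⟨w₀, hw₀⟩ := hex
    set s₀ : Set.powersetCard (Fin n) k :=
      Set.powersetCard.ofFinEmbEquiv (OrderEmbedding.ofStrictMono w₀ hw₀) with hs₀
    have hs₀w : ((subsetEmb s₀ : Fin k ↪o Fin n) : Fin k → Fin n) = w₀ := coe_subsetEmb_ofFinEmbEquiv hw₀
    -- `e[dx_{w₀}] = g • ξ_{w₀}` is a rational class, so its `s₀`-coordinate `g` is rational
    have hrat : IsRationalClass (g • (torusMonomialBasis ℂ n k) s₀) := by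
      have h := isRationalClass_of_mem_rationalForms Φ hr
        (ComplexTorus.latMonomial_mem_rationalForms Φ k w₀)
      rw [hg w₀ hw₀] at h
      rw [torusMonomialBasis_apply, hs₀w]
      exact h
    have hcoord := torusMonomialBasis_repr_mem_range_ratCast hrat s₀
    rw [map_smul, Module.Basis.repr_self, Finsupp.smul_apply, Finsupp.single_eq_same, smul_eq_mul,
      mul_one] at hcoord
    obtain ⟨q, hq⟩ := hcoord
    refine ⟨q, ?_, fun w hw ↦ by rw [hg w hw, ← hq]⟩
    rintro rfl
    exact hg0 (by rw [← hq, Rat.cast_zero])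
  · exact ⟨1, one_ne_zero, fun w hw ↦ (hex ⟨w, hw⟩).elim⟩

/-- **`Fin n` form.** For a NATURAL family RATIONALLY NORMALISED in degree `k`, the singular class
`e_X[γ]` of an invariant form on `X = E/Φ(ℤⁿ)` is rational iff `γ ∈ Hᵏ(X, ℚ) = rationalForms Φ k`
(`←` is `isRationalClass_of_mem_rationalForms`; `→`: `e_X[γ] = Σ_s c_s ξ_s` with `c_s ∈ ℚ` and
`ξ_s = e_X[q⁻¹ dx_s]`, so `γ = Σ_s (c_s/q) dx_s`). [cite: Lange2023AbelianVarietiesComplex, §1.1.3 Cor. 1.1.19 and §1.1.4 Prop. 1.1.20] -/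
theorem isRationalClass_iff_mem_rationalForms_of_isRational_fin (he : e.IsNatural)
    (hr : IsRationalDeRhamFamily e k) {γ : E [⋀^Fin k]→L[ℝ] ℂ} :
    IsRationalClass (e (ComplexTorus Φ) k (ComplexTorus.cconstClass Φ γ)) ↔
      γ ∈ ComplexTorus.rationalForms Φ k := by
  refine ⟨fun hγ ↦ ?_, isRationalClass_of_mem_rationalForms Φ hr⟩
  obtain ⟨q, hq0, hq⟩ := exists_ratCast_apply_cconstClass_latMonomial_eq_smul Φ he hr
  obtain ⟨c, hc⟩ := (isRationalClass_iff_exists_eq_sum_ratCast_smul _).1 hγ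
  have hq0' : ((q : ℚ) : ℂ) ≠ 0 := Rat.cast_ne_zero.2 hq0
  -- `γ = Σ_s (c_s / q) dx_s`, comparing classes
  have hγeq : γ = ∑ s, ((c s / q : ℚ) : ℂ) • ComplexTorus.latMonomial Φ k (subsetEmb s) := by
    apply injective_apply_cconstClass Φ e
    change e (ComplexTorus Φ) k (ComplexTorus.cconstClass Φ γ) =
      e (ComplexTorus Φ) k (ComplexTorus.cconstClass Φ
        (∑ s, ((c s / q : ℚ) : ℂ) • ComplexTorus.latMonomial Φ k (subsetEmb s)))
    rw [hc, _root_.map_sum, _root_.map_sum]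
    refine Finset.sum_congr rfl fun s _ ↦ ?_
    rw [LinearMap.map_smul, LinearEquiv.map_smul, hq _ (subsetEmb s).strictMono]
    change ((c s : ℚ) : ℂ) • torusMonomial ℂ n k (subsetEmb s) =
      ((c s / q : ℚ) : ℂ) • (((q : ℚ) : ℂ) • torusMonomial ℂ n k (subsetEmb s))
    rw [smul_smul, Rat.cast_div, div_mul_cancel₀ _ hq0']
  rw [hγeq]
  refine Submodule.sum_mem _ fun s _ ↦ ?_
  have hmem := Submodule.smul_mem (ComplexTorus.rationalForms Φ k) (c s / q)
    (ComplexTorus.latMonomial_mem_rationalForms Φ k (subsetEmb s))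
  rwa [← Rat.cast_smul_eq_qsmul ℂ (c s / q)] at hmem

end RationallyNormalised

/-! ### §3 Arbitrary finite index types -/

section AnyIndex

variable {ι : Type} [Fintype ι] {E : Type} [NormedAddCommGroup E] [NormedSpace ℂ E]
  (Φ : (ι → ℝ) ≃L[ℝ] E) {k : ℕ} {e : ComplexDeRhamIsoFamily E}

/-- **Rational classes ↔ rational periods, for a rationally normalised natural family and ANY finite
index type**: if `e` is natural and `IsRationalDeRhamFamily e k`, then for the complex torus
`X = E/Φ(ℤ^ι)` and every invariant `k`-form `γ`, `e_X[γ]` is a rational class iff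
`γ ∈ Hᵏ(X, ℚ) = rationalForms Φ k` (Lange 2023, Cor. 1.1.19 / Prop. 1.1.20: "`Hⁿ(X, ℚ)` = the invariant
forms with rational periods"; reduce to the `Fin |ι|`-indexed presentation `ComplexTorus.reindex`, which
has the same lattice, by the transport of §1). The implication `←` alone is
`isRationalClass_of_mem_rationalForms` (`ComplexTorusHodgeClassesComparison.lean`).
[cite: Lange2023AbelianVarietiesComplex, §1.1.3 Cor. 1.1.19 and §1.1.4 Prop. 1.1.20] -/
theorem isRationalClass_iff_mem_rationalForms_of_isRational (he : e.IsNatural)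
    (hr : IsRationalDeRhamFamily e k) {γ : E [⋀^Fin k]→L[ℝ] ℂ} :
    IsRationalClass (e (ComplexTorus Φ) k (ComplexTorus.cconstClass Φ γ)) ↔
      γ ∈ ComplexTorus.rationalForms Φ k := by
  let β : ι ≃ Fin (Fintype.card ι) := Fintype.equivFin ι
  rw [isRationalClass_apply_cconstClass_iff_of_realRep_eq_id Φ (ComplexTorus.reindex Φ β) he
      (ComplexTorus.reindexMatrix β) (ComplexTorus.realRep_reindexMatrix Φ β)
      (ComplexTorus.reindexMatrixInv β) (ComplexTorus.realRep_reindexMatrixInv Φ β),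
    isRationalClass_iff_mem_rationalForms_of_isRational_fin (ComplexTorus.reindex Φ β) he hr,
    ComplexTorus.rationalForms_reindex]

/-- The de Rham class of an invariant form lies in `H^{p,q}(X)` iff the form has type `(p,q)`
(`H^{p,q}(X) = [Λ^{p,q}]`, `ComplexTorus.hodgePQ_eq_map_typeSubmodule`, Lange 2023 Thm. 1.1.21, and
`[·]` is injective on invariant forms). [cite: Lange2023AbelianVarietiesComplex, §1.1.5 Thm. 1.1.21] -/
theorem cconstClass_mem_hodgePQ_iff {p q : ℕ} {γ : E [⋀^Fin k]→L[ℝ] ℂ} :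
    ComplexTorus.cconstClass Φ γ ∈ hodgePQ E (ComplexTorus Φ) k p q ↔
      γ ∈ Literature.Analysis.Complex.typeSubmodule E k p q := by
  haveI : FiniteDimensional ℝ E := LinearEquiv.finiteDimensional Φ.toLinearEquiv
  haveI : FiniteDimensional ℂ E := Module.Finite.of_restrictScalars_finite ℝ ℂ E
  rw [ComplexTorus.hodgePQ_eq_map_typeSubmodule, Submodule.mem_map]
  refine ⟨?_, fun h ↦ ⟨γ, h, rfl⟩⟩
  rintro ⟨γ', hγ', h⟩
  rwa [← (ComplexTorus.cconstClassEquiv Φ (k := k)).injective h]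

/-- **The concrete Hodge classes are exactly the invariant forms with a RATIONAL `(p,p)` CLASS** (for a
natural family rationally normalised in degree `k`): `γ ∈ hodgeClassesIn Φ k p` iff `e_X[γ]` is a
rational class and `[γ] ∈ H^{p,p}(X)` — the model layer's notion of a Hodge class
(`H^{2p}(X, ℚ) ∩ H^{p,p}(X)`, Lange 2023 §7.2.2) read on the concrete carrier; the implication from
left to right alone is `hodgeClasses_comparison` (`ComplexTorusHodgeClassesComparison.lean`).
[cite: Lange2023AbelianVarietiesComplex, §7.2.2] -/
theorem mem_hodgeClassesIn_iff_isRationalClass_of_isRational (he : e.IsNatural)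
    (hr : IsRationalDeRhamFamily e k) {p : ℕ} {γ : E [⋀^Fin k]→L[ℝ] ℂ} :
    γ ∈ ComplexTorus.hodgeClassesIn Φ k p ↔
      IsRationalClass (e (ComplexTorus Φ) k (ComplexTorus.cconstClass Φ γ)) ∧
        ComplexTorus.cconstClass Φ γ ∈ hodgePQ E (ComplexTorus Φ) k p p := by
  rw [ComplexTorus.mem_hodgeClassesIn_iff, isRationalClass_iff_mem_rationalForms_of_isRational Φ he hr,
    cconstClass_mem_hodgePQ_iff]

/-- The same for `hodgeClasses Φ p = H^{2p}_Hodge(X)`: `γ` is a concrete Hodge class iff `e_X[γ]` is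
rational and `[γ] ∈ H^{p,p}(X)`. [cite: Lange2023AbelianVarietiesComplex, §7.2.2] -/
theorem mem_hodgeClasses_iff_isRationalClass_of_isRational {e : ComplexDeRhamIsoFamily E} {p : ℕ}
    (he : e.IsNatural) (hr : IsRationalDeRhamFamily e (2 * p)) {γ : E [⋀^Fin (2 * p)]→L[ℝ] ℂ} :
    γ ∈ ComplexTorus.hodgeClasses Φ p ↔
      IsRationalClass (e (ComplexTorus Φ) (2 * p) (ComplexTorus.cconstClass Φ γ)) ∧
        ComplexTorus.cconstClass Φ γ ∈ hodgePQ E (ComplexTorus Φ) (2 * p) p p :=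
  mem_hodgeClassesIn_iff_isRationalClass_of_isRational Φ he hr

variable {n : ℕ} (β : ι ≃ Fin n)

/-- **Integral dictionary, any index type.** If the natural family `e` is normalised on the `Fin n`
presentation `reindex Φ β` of `X` in degree `k` (such a family exists,
`exists_isNatural_normalised (reindex Φ β) k`), then `e_X[γ]` is an integral class iff
`γ ∈ Hᵏ(X, ℤ) = integralForms Φ k`. [cite: Lange2023AbelianVarietiesComplex, §1.1.3 Lemma 1.1.17 and §1.1.4 Prop. 1.1.20] -/
theorem isIntegralClass_iff_mem_integralForms_of_normalised_reindex (he : e.IsNatural)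
    (hn : ∀ x : singularCohomology ℤ ℤ (Torus n) k,
      e (ComplexTorus (ComplexTorus.reindex Φ β)) k (ComplexTorus.cconstClass (ComplexTorus.reindex Φ β)
          (ComplexTorus.normalisedComparison (ComplexTorus.reindex Φ β) k x)) =
        singularCohomology.ringChange (Int.castRingHom ℂ) (Torus n) k x)
    {γ : E [⋀^Fin k]→L[ℝ] ℂ} :
    IsIntegralClass (e (ComplexTorus Φ) k (ComplexTorus.cconstClass Φ γ)) ↔
      γ ∈ ComplexTorus.integralForms Φ k := by
  rw [isIntegralClass_apply_cconstClass_iff_of_realRep_eq_id Φ (ComplexTorus.reindex Φ β) he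
      (ComplexTorus.reindexMatrix β) (ComplexTorus.realRep_reindexMatrix Φ β)
      (ComplexTorus.reindexMatrixInv β) (ComplexTorus.realRep_reindexMatrixInv Φ β),
    isIntegralClass_iff_mem_integralForms (ComplexTorus.reindex Φ β) hn, ComplexTorus.integralForms_reindex]

/-- **Rational dictionary, any index type**, for a family normalised on the `Fin n` presentation
`reindex Φ β`: `e_X[γ]` is a rational class iff `γ ∈ Hᵏ(X, ℚ) = rationalForms Φ k`.
[cite: Lange2023AbelianVarietiesComplex, §1.1.3 Cor. 1.1.19 and §1.1.4 Prop. 1.1.20] -/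
theorem isRationalClass_iff_mem_rationalForms_of_normalised_reindex (he : e.IsNatural)
    (hn : ∀ x : singularCohomology ℤ ℤ (Torus n) k,
      e (ComplexTorus (ComplexTorus.reindex Φ β)) k (ComplexTorus.cconstClass (ComplexTorus.reindex Φ β)
          (ComplexTorus.normalisedComparison (ComplexTorus.reindex Φ β) k x)) =
        singularCohomology.ringChange (Int.castRingHom ℂ) (Torus n) k x)
    {γ : E [⋀^Fin k]→L[ℝ] ℂ} :
    IsRationalClass (e (ComplexTorus Φ) k (ComplexTorus.cconstClass Φ γ)) ↔
      γ ∈ ComplexTorus.rationalForms Φ k := by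
  rw [isRationalClass_apply_cconstClass_iff_of_realRep_eq_id Φ (ComplexTorus.reindex Φ β) he
      (ComplexTorus.reindexMatrix β) (ComplexTorus.realRep_reindexMatrix Φ β)
      (ComplexTorus.reindexMatrixInv β) (ComplexTorus.realRep_reindexMatrixInv Φ β),
    isRationalClass_iff_mem_rationalForms (ComplexTorus.reindex Φ β) hn, ComplexTorus.rationalForms_reindex]

end AnyIndex

end Literature.AlgebraicGeometry.HodgeTheory

end

-- buildfix 2026-08-21 (ops-buildfix-2): comment-only re-land to re-queue the hub build of this module
-- (accepted 06:40-07:30Z but never dispatched to the build lane, HOME LEDGER G11b-3); no declaration changed.
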